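import Literature.Geometry.Manifold.VectorSpaceGlobalFlow
import Summits.SmoothPoincare4.SmoothPoincare4.Theorems.DottedCircleRasmussenDcrGapStubFriendsH2HF1
import Summits.SmoothPoincare4.SmoothPoincare4.Theorems.DottedCircleRasmussenDcrGapStubFriendsH2HF2

/-!
# Helper `helper_modelHandlebody_localHomology_finite` of stub `stub_friendsH2` — part 3: the deformation
(item stmt-SmoothPoincare4-16128, route route-SmoothPoincare4-DottedCircleRasmussen)

**`H_q(ℝ⁴ | D_k; ℚ)` is finite-dimensional for `q = 2, 3`** (`D_k = MMSW.modelHandlebody k` the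
model dotted handlebody `{G_k ≤ 1}`), the only input about `D_k` of the `H₂`-leaf of the friends
lemma.  By parts 1–2 it suffices to deform `U = B(0, R + 3) ∖ D_k` (`R = 40(k+1)`) into an open
set with compact closure in `U`.  The deformation is Milnor's (Morse theory, Thm. 3.1: push
`{G > 1}` up through the critical-point-free band `1 ≤ G ≤ 1 + ε` along the gradient of `G`),
followed by a radial squeeze of the outer shell:

* the field `W = χ · ∇G/2`, `χ = φ(G_k)` on the open set where all hole terms exceed `1/4` and
  `0` elsewhere (`φ` the plateau cutoff of part 2, `ε = 1/(4R)`), is smooth with compact support,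
  and `dG_k(W) = 2χ S`, `S = |∇G_k/2|² > 0` on the band (`MMSW.gradSq_pos` where the planar
  potential is `≥ 19/20`, the `w`-part otherwise); its flow `θ` exists for all times
  (`Literature.Geometry.Manifold.exists_contDiff_globalFlow`);
* along a non-stationary orbit `χ ≠ 0`, so the orbit stays in `{1 - ε < G < 1 + 2ε} ⊂ B(0, R + 2)`,
  `G` increases, at speed `≥ 2m` while `G ≤ 1 + ε` (`m` the minimum of `S` on the compact band), so
  a point of `U` near `D_k` is carried into `{G > 1 + ε}` by time `T = ε/m + 1`, never entering
  `D_k = {G ≤ 1}`; stationary points of `U` already lie in the target;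
* the radial squeeze `S₁` (part 2) then moves the shell `R + 2 ≤ ‖y‖ < R + 3` into `‖y‖ < R + 5/2`.

`FriendsH2.exists_deformation_ball_diff_modelHandlebody` packages the deformation;
`helper_modelHandlebody_localHomology_finite` (registered helper of the line) follows by part 1.
Everything is proved; no definitions, no named facts, no `sorry`.

## References

* J. Milnor, *Morse theory*, Ann. of Math. Studies 51 (1963), Thm. 3.1. [Milnor1963]
* G. E. Bredon, *Sheaf Theory*, 2nd ed., GTM 170, Springer 1997, §II.17. [Bredon1997]
-/

-- the prescribed namespace `Summit.<P>.<Sub>.…` duplicates `SmoothPoincare4` (P = Sub)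
set_option linter.dupNamespace false
set_option linter.style.longLine false

noncomputable section

open scoped ContDiff Topology
open CategoryTheory Limits Set Function Metric Filter
open Literature.AlgebraicTopology.SingularHomology Literature.Topology.FourManifolds
open Literature.Topology.FourManifolds.MMSW

namespace Summit.SmoothPoincare4.SmoothPoincare4.Theorems.DcrGap.MkFriends

namespace FriendsH2

/-! ## Elementary inequalities for the level function -/

/-- Off the poles every term of `G_k` is nonnegative: `(y₀² + y₁²)/R² ≤ G_k y`, `y₂² + y₃² ≤ G_k y`
and `1/|z - c_j|² ≤ G_k y`. [folklore] -/
theorem levelFun_bounds {k : ℕ} {y : EuclideanSpace ℝ (Fin 4)} (hy : ∀ j, 0 < holeTerm k j y) :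
    (y 0 ^ 2 + y 1 ^ 2) / (40 * ((k : ℝ) + 1)) ^ 2 ≤ levelFun k y ∧
      y 2 ^ 2 + y 3 ^ 2 ≤ levelFun k y ∧ ∀ j, 1 / holeTerm k j y ≤ levelFun k y := by
  have hS : ∀ j, 0 ≤ 1 / holeTerm k j y := fun j => (one_div_pos.2 (hy j)).le
  have hsum : 0 ≤ ∑ j : Fin k, 1 / holeTerm k j y := Finset.sum_nonneg fun j _ => hS j
  have h1 : 0 ≤ (y 0 ^ 2 + y 1 ^ 2) / (40 * ((k : ℝ) + 1)) ^ 2 := by positivity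
  refine ⟨?_, ?_, fun j => ?_⟩
  · simp only [levelFun]; nlinarith [sq_nonneg (y 2), sq_nonneg (y 3)]
  · simp only [levelFun]; nlinarith
  · have := Finset.single_le_sum (fun i _ => hS i) (Finset.mem_univ j)
    simp only [levelFun]; nlinarith [sq_nonneg (y 2), sq_nonneg (y 3)]

/-- Off the poles, `‖y‖² ≤ G_k(y) (R² + 1)`. [folklore] -/
theorem norm_sq_le_levelFun {k : ℕ} {y : EuclideanSpace ℝ (Fin 4)} (hy : ∀ j, 0 < holeTerm k j y) :
    ‖y‖ ^ 2 ≤ levelFun k y * ((40 * ((k : ℝ) + 1)) ^ 2 + 1) := by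
  obtain ⟨h1, h2, -⟩ := levelFun_bounds hy
  have hR : 0 < (40 * ((k : ℝ) + 1)) ^ 2 := by positivity
  rw [div_le_iff₀ hR] at h1
  rw [EuclideanSpace.norm_sq_eq]
  simp only [Real.norm_eq_abs, sq_abs, Fin.sum_univ_four]
  nlinarith

/-- A point outside `D_k` and off the poles has `G_k > 1` (either the guard holds and `G_k ≤ 1`
fails, or some hole term is `< 1` and already `1/|z - c_j|² > 1`). [folklore] -/
theorem one_lt_levelFun_of_not_mem {k : ℕ} {y : EuclideanSpace ℝ (Fin 4)} (hy : ∀ j, 0 < holeTerm k j y)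
    (hyD : y ∉ modelHandlebody k) : 1 < levelFun k y := by
  by_cases hg : ∀ j : Fin k, (1 : ℝ) ≤ holeTerm k j y
  · exact not_le.1 fun h => hyD ⟨hg, h⟩
  · push Not at hg
    obtain ⟨j, hj⟩ := hg
    have h1 : 1 < 1 / holeTerm k j y := by rw [lt_one_div one_pos (hy j), div_one]; exact hj
    exact h1.trans_le ((levelFun_bounds hy).2.2 j)

/-- If `G_k(y) < 2` off the poles then every hole term exceeds `1/2`. [folklore] -/
theorem half_lt_holeTerm_of_levelFun_lt_two {k : ℕ} {y : EuclideanSpace ℝ (Fin 4)}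
    (hy : ∀ j, 0 < holeTerm k j y) (h2 : levelFun k y < 2) (j : Fin k) : 1 / 2 < holeTerm k j y := by
  have h := ((levelFun_bounds hy).2.2 j).trans_lt h2
  rw [div_lt_iff₀ (hy j)] at h
  linarith

/-- Off the poles, `G_k(y) ≤ 1 + 2ε` (`ε = 1/(4R)`, `R = 40(k+1)`) forces `‖y‖ < R + 2`. [folklore] -/
theorem norm_lt_of_levelFun_le {k : ℕ} {y : EuclideanSpace ℝ (Fin 4)} (hy : ∀ j, 0 < holeTerm k j y)
    (hG : levelFun k y ≤ 1 + 2 * (1 / (4 * (40 * ((k : ℝ) + 1))))) :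
    ‖y‖ < 40 * ((k : ℝ) + 1) + 2 := by
  have hR : (40 : ℝ) ≤ 40 * ((k : ℝ) + 1) := by nlinarith [(k.cast_nonneg : (0 : ℝ) ≤ k)]
  set R : ℝ := 40 * ((k : ℝ) + 1) with hRdef
  have h1 := norm_sq_le_levelFun hy
  rw [← hRdef] at h1
  have hR0 : 0 < R := by linarith
  have h2 : levelFun k y * (R ^ 2 + 1) ≤ (1 + 2 * (1 / (4 * R))) * (R ^ 2 + 1) :=
    mul_le_mul_of_nonneg_right hG (by positivity)
  have h3 : (1 + 2 * (1 / (4 * R))) * (R ^ 2 + 1) = R ^ 2 + R / 2 + 1 + 1 / (2 * R) := by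
    field_simp; ring
  have h4 : 1 / (2 * R) ≤ 1 := by rw [div_le_one (by positivity)]; linarith
  have h5 : ‖y‖ ^ 2 < (R + 2) ^ 2 := by nlinarith
  exact lt_of_pow_lt_pow_left₀ 2 (by positivity) h5

/-! ## The pushing flow -/

/-- **Milnor's push through the regular band `1 ≤ G_k ≤ 1 + ε`** (Morse theory, Thm. 3.1), for the
model level function on `ℝ⁴`: there are a continuous flow `θ` (of the compactly supported smooth
field `χ ∇G_k/2`) and a time `T ≥ 0` such that, with `R = 40(k+1)`, `ε = 1/(4R)`:
orbits starting in `U = B(0, R + 3) ∖ D_k` stay in `U` for positive times, and at time `T` every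
point of `U` is either stationary and off `{guard ≥ 1/2, G_k ≤ 1 + ε}`, or has been carried into
`{G_k > 1 + ε} ∩ B(0, R + 2)`. [cite: Milnor1963, Thm. 3.1] -/
theorem exists_pushing_flow (k : ℕ) :
    ∃ (θ : ℝ × EuclideanSpace ℝ (Fin 4) → EuclideanSpace ℝ (Fin 4)) (T : ℝ),
      Continuous θ ∧ (∀ x, θ (0, x) = x) ∧ 0 ≤ T ∧
      (∀ y : EuclideanSpace ℝ (Fin 4), ‖y‖ < 40 * ((k : ℝ) + 1) + 3 → y ∉ modelHandlebody k →
        ∀ t : ℝ, 0 ≤ t → ‖θ (t, y)‖ < 40 * ((k : ℝ) + 1) + 3 ∧ θ (t, y) ∉ modelHandlebody k) ∧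
      (∀ y : EuclideanSpace ℝ (Fin 4), ‖y‖ < 40 * ((k : ℝ) + 1) + 3 → y ∉ modelHandlebody k →
        (θ (T, y) = y ∧ ¬ ((∀ j, (1 : ℝ) / 2 ≤ holeTerm k j y) ∧
            levelFun k y ≤ 1 + 1 / (4 * (40 * ((k : ℝ) + 1))))) ∨
        (‖θ (T, y)‖ < 40 * ((k : ℝ) + 1) + 2 ∧
          1 + 1 / (4 * (40 * ((k : ℝ) + 1))) < levelFun k (θ (T, y)))) := by
  -- constants
  have hR40 : (40 : ℝ) ≤ 40 * ((k : ℝ) + 1) := by nlinarith [(k.cast_nonneg : (0 : ℝ) ≤ k)]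
  set ε : ℝ := 1 / (4 * (40 * ((k : ℝ) + 1))) with hε
  have hε0 : 0 < ε := by positivity
  have hε1 : ε ≤ 1 / 160 := by
    rw [hε, div_le_div_iff₀ (by positivity) (by norm_num)]; linarith
  -- the cutoff, the half-gradient, the field
  set φ : ℝ → ℝ := fun g => Real.smoothTransition ((g - (1 - ε)) / ε) *
    Real.smoothTransition ((1 + 2 * ε - g) / ε) with hφ
  set a : EuclideanSpace ℝ (Fin 4) → ℝ := fun y => y 0 / (40 * ((k : ℝ) + 1)) ^ 2 -
    ∑ j : Fin k, (y 0 - 4 * (((j : ℕ) : ℝ) + 1)) / holeTerm k j y ^ 2 with ha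
  set b : EuclideanSpace ℝ (Fin 4) → ℝ := fun y => y 1 / (40 * ((k : ℝ) + 1)) ^ 2 -
    ∑ j : Fin k, y 1 / holeTerm k j y ^ 2 with hb
  set gradG : EuclideanSpace ℝ (Fin 4) → EuclideanSpace ℝ (Fin 4) :=
    fun y => !₂[a y, b y, y 2, y 3] with hgradG
  set S : EuclideanSpace ℝ (Fin 4) → ℝ := fun y => a y ^ 2 + b y ^ 2 + y 2 ^ 2 + y 3 ^ 2 with hS
  set χ : EuclideanSpace ℝ (Fin 4) → ℝ :=
    fun y => if ∀ j : Fin k, (1 : ℝ) / 4 < holeTerm k j y then φ (levelFun k y) else 0 with hχ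
  set W : EuclideanSpace ℝ (Fin 4) → EuclideanSpace ℝ (Fin 4) := fun y => χ y • gradG y with hW
  -- `dG(gradG) = 2 S`
  have hfd : ∀ y, (∀ j, holeTerm k j y ≠ 0) → fderiv ℝ (levelFun k) y (gradG y) = 2 * S y := by
    intro y hy
    rw [fderiv_levelFun_apply hy]
    simp only [hgradG, hS, ha, hb]
    simp
    ring
  -- `S > 0` on `{G ≥ 1 - ε}`
  have hSpos : ∀ y, (∀ j, holeTerm k j y ≠ 0) → 1 - ε ≤ levelFun k y → 0 < S y := by
    intro y hy hG
    by_cases hg : 19 / 20 ≤ levelFun k y - ((y 2) ^ 2 + (y 3) ^ 2)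
    · have h := gradSq_pos hy hg
      simp only [hS, ha, hb]
      nlinarith [sq_nonneg (y 2), sq_nonneg (y 3)]
    · push Not at hg
      have h1 : 0 < (y 2) ^ 2 + (y 3) ^ 2 := by linarith
      simp only [hS]
      nlinarith [sq_nonneg (a y), sq_nonneg (b y)]
  -- the cutoff `χ`
  have hχ01 : ∀ y, 0 ≤ χ y ∧ χ y ≤ 1 := by
    intro y
    simp only [hχ]
    split_ifs
    · exact ⟨(cutoff_mem_Icc ε _).1, (cutoff_mem_Icc ε _).2⟩
    · exact ⟨le_rfl, zero_le_one⟩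
  have hχne : ∀ y, χ y ≠ 0 → (∀ j, (1 : ℝ) / 4 < holeTerm k j y) ∧
      1 - ε < levelFun k y ∧ levelFun k y < 1 + 2 * ε := by
    intro y h
    simp only [hχ] at h
    split_ifs at h with h4
    · exact ⟨h4, cutoff_ne_zero hε0 h⟩
    · exact absurd rfl h
  have hχeq : ∀ y, (∀ j, (1 : ℝ) / 4 < holeTerm k j y) → χ y = φ (levelFun k y) := fun y h => by
    simp only [hχ, if_pos h]
  have hpos4 : ∀ y, (∀ j, (1 : ℝ) / 4 < holeTerm k j y) → ∀ j, 0 < holeTerm k j y :=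
    fun y h j => lt_trans (by norm_num) (h j)
  have hnorm : ∀ y, χ y ≠ 0 → ‖y‖ < 40 * ((k : ℝ) + 1) + 2 := fun y h =>
    norm_lt_of_levelFun_le (hpos4 y (hχne y h).1) (hχne y h).2.2.le
  -- smoothness of the field
  have hgrad : ∀ y, (∀ j, holeTerm k j y ≠ 0) → ContDiffAt ℝ ∞ gradG y := by
    intro y hy
    rw [contDiffAt_euclidean]
    intro i
    fin_cases i
    · simpa [hgradG] using contDiffAt_gRe hy
    · simpa [hgradG] using contDiffAt_gIm hy
    · simp [hgradG]; fun_prop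
    · simp [hgradG]; fun_prop
  have hWs : ContDiff ℝ ∞ W := by
    rw [contDiff_iff_contDiffAt]
    intro y
    by_cases hy4 : ∀ j : Fin k, (1 : ℝ) / 4 < holeTerm k j y
    · have hy0 : ∀ j, holeTerm k j y ≠ 0 := fun j => (hpos4 y hy4 j).ne'
      have hev : W =ᶠ[𝓝 y] fun y' => φ (levelFun k y') • gradG y' := by
        filter_upwards [(isOpen_guard (1 / 4)).mem_nhds hy4] with y' hy'
        simp only [hW, hχeq y' hy']
      refine ContDiffAt.congr_of_eventuallyEq ?_ hev
      exact ((cutoff_contDiff ε).contDiffAt.comp y (contDiffAt_levelFun hy0)).smul (hgrad y hy0)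
    · push Not at hy4
      obtain ⟨j, hj⟩ := hy4
      have hev : W =ᶠ[𝓝 y] fun _ => 0 := by
        have hopen : IsOpen {y' : EuclideanSpace ℝ (Fin 4) | holeTerm k j y' < 1 / 2} :=
          isOpen_lt (continuous_holeTerm j) continuous_const
        filter_upwards [hopen.mem_nhds (show holeTerm k j y < 1 / 2 by linarith)]
          with y' hy'
        have hχ0 : χ y' = 0 := by
          by_contra h
          obtain ⟨h4, -, hlt⟩ := hχne y' h
          have h2 := (levelFun_bounds (hpos4 y' h4)).2.2 j
          have h3 : 2 < 1 / holeTerm k j y' := by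
            rw [lt_one_div two_pos (hpos4 y' h4 j)]; exact hy'
          linarith
        simp only [hW, hχ0, zero_smul]
      exact (contDiffAt_const (c := (0 : EuclideanSpace ℝ (Fin 4)))).congr_of_eventuallyEq hev
  -- compact support
  have hWK : ∀ y, y ∉ closedBall (0 : EuclideanSpace ℝ (Fin 4)) (40 * ((k : ℝ) + 1) + 2) → W y = 0 := by
    intro y hy
    by_contra h
    have hχ0 : χ y ≠ 0 := fun h0 => h (by simp only [hW, h0, zero_smul])
    exact hy (mem_closedBall_zero_iff.2 (hnorm y hχ0).le)
  -- zeros of the field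
  have hWχ : ∀ y, W y = 0 → χ y = 0 := by
    intro y hWy
    by_contra h
    obtain ⟨h4, hG, -⟩ := hχne y h
    have hy0 : ∀ j, holeTerm k j y ≠ 0 := fun j => (hpos4 y h4 j).ne'
    have hg0 : gradG y = 0 := (smul_eq_zero.1 hWy).resolve_left h
    have h1 := hfd y hy0
    rw [hg0, map_zero] at h1
    linarith [hSpos y hy0 hG.le]
  -- the flow
  obtain ⟨θ, hθs, h0, hadd, hint, hfix⟩ := Literature.Geometry.Manifold.exists_contDiff_globalFlow hWs
    (isCompact_closedBall (0 : EuclideanSpace ℝ (Fin 4)) (40 * ((k : ℝ) + 1) + 2)) hWK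
  have hdich := fun x => flow_dichotomy h0 hadd hfix (W := W) x
  -- the band and the lower bound `m`
  set B : Set (EuclideanSpace ℝ (Fin 4)) := {y | ∀ j : Fin k, (1 : ℝ) / 2 ≤ holeTerm k j y} ∩
    levelFun k ⁻¹' Icc (1 - ε) (1 + 2 * ε) with hB
  have hBc : IsCompact B := by
    refine Metric.isCompact_of_isClosed_isBounded ?_ ?_
    · exact (continuousOn_levelFun (by norm_num : (0 : ℝ) < 1 / 2)).preimage_isClosed_of_isClosed
        (isClosed_guard (1 / 2)) isClosed_Icc
    · refine (isBounded_closedBall (x := (0 : EuclideanSpace ℝ (Fin 4)))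
        (r := 40 * ((k : ℝ) + 1) + 2)).subset fun y hy => mem_closedBall_zero_iff.2 ?_
      exact (norm_lt_of_levelFun_le (fun j => lt_of_lt_of_le (by norm_num) (hy.1 j)) hy.2.2).le
  have hBne0 : ∀ y ∈ B, ∀ j, holeTerm k j y ≠ 0 := fun y hy j =>
    (lt_of_lt_of_le (by norm_num) (hy.1 j)).ne'
  have hScont : ContinuousOn S B := by
    intro y hy
    have hy0 := hBne0 y hy
    refine ContinuousAt.continuousWithinAt ?_
    simp only [hS]
    exact ((((contDiffAt_gRe hy0).continuousAt.pow 2).add ((contDiffAt_gIm hy0).continuousAt.pow 2)).add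
      (((EuclideanSpace.proj (2 : Fin 4)).continuous.continuousAt).pow 2)).add
      (((EuclideanSpace.proj (3 : Fin 4)).continuous.continuousAt).pow 2)
  obtain ⟨m, hm0, hmB⟩ : ∃ m : ℝ, 0 < m ∧ ∀ y ∈ B, m ≤ S y := by
    rcases B.eq_empty_or_nonempty with hBe | hBne
    · exact ⟨1, one_pos, fun y hy => by simp [hBe] at hy⟩
    · obtain ⟨y₀, hy₀, hmin⟩ := hBc.exists_isMinOn hBne hScont
      exact ⟨S y₀, hSpos y₀ (hBne0 y₀ hy₀) hy₀.2.1, fun y hy => hmin hy⟩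
  -- the time
  set T : ℝ := ε / m + 1 with hT
  have hT0 : 0 ≤ T := by positivity
  -- moving orbits
  have hmov : ∀ x : EuclideanSpace ℝ (Fin 4), x ∉ modelHandlebody k → (∀ t, W (θ (t, x)) ≠ 0) →
      (∀ t, ‖θ (t, x)‖ < 40 * ((k : ℝ) + 1) + 2) ∧
      (∀ t, 0 ≤ t → levelFun k x ≤ levelFun k (θ (t, x))) ∧ 1 < levelFun k x ∧
      1 + ε < levelFun k (θ (T, x)) := by
    intro x hxD hxW
    have hχt : ∀ t, χ (θ (t, x)) ≠ 0 := fun t h => hxW t (by simp only [hW, h, zero_smul])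
    have h4t : ∀ t j, (1 : ℝ) / 4 < holeTerm k j (θ (t, x)) := fun t => (hχne _ (hχt t)).1
    have h0t : ∀ t j, holeTerm k j (θ (t, x)) ≠ 0 := fun t j => (hpos4 _ (h4t t) j).ne'
    have hGt : ∀ t, 1 - ε < levelFun k (θ (t, x)) ∧ levelFun k (θ (t, x)) < 1 + 2 * ε :=
      fun t => (hχne _ (hχt t)).2
    have hnt : ∀ t, ‖θ (t, x)‖ < 40 * ((k : ℝ) + 1) + 2 := fun t => hnorm _ (hχt t)
    -- `G` along the orbit
    have hg : ∀ t, HasDerivAt (fun t => levelFun k (θ (t, x)))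
        (χ (θ (t, x)) * (2 * S (θ (t, x)))) t := by
      intro t
      have hG : HasFDerivAt (levelFun k) (fderiv ℝ (levelFun k) (θ (t, x))) (θ (t, x)) :=
        ((contDiffAt_levelFun (h0t t)).differentiableAt (by simp)).hasFDerivAt
      have h := hG.comp_hasDerivAt t (hint x t)
      have hval : fderiv ℝ (levelFun k) (θ (t, x)) (W (θ (t, x))) =
          χ (θ (t, x)) * (2 * S (θ (t, x))) := by
        simp only [hW, map_smul, smul_eq_mul, hfd _ (h0t t)]
      rwa [hval] at h
    have hnn : ∀ t, 0 ≤ χ (θ (t, x)) * (2 * S (θ (t, x))) := fun t =>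
      mul_nonneg (hχ01 _).1 (mul_nonneg zero_le_two (by simp only [hS]; positivity))
    have hmono : Monotone fun t => levelFun k (θ (t, x)) :=
      monotone_of_deriv_nonneg (fun t => (hg t).differentiableAt) fun t => by
        rw [(hg t).deriv]; exact hnn t
    have hx1 : 1 < levelFun k x := by
      have := one_lt_levelFun_of_not_mem (hpos4 _ (h0 x ▸ h4t 0)) hxD
      exact this
    refine ⟨hnt, fun t ht => ?_, hx1, ?_⟩
    · have := hmono ht
      simpa only [h0] using this
    · refine lt_of_hasDerivAt_of_band hg hnn (a := 1) (b := 1 + ε) (m := 2 * m) (by positivity)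
        (by simpa only [h0] using hx1) (fun t h1 h2 => ?_) ?_ hT0
      · have hB' : θ (t, x) ∈ B :=
          ⟨fun j => (half_lt_holeTerm_of_levelFun_lt_two (hpos4 _ (h4t t)) (by linarith [(hGt t).2]) j).le,
            (hGt t).1.le, (hGt t).2.le⟩
        have hφ1 : χ (θ (t, x)) = 1 := by
          rw [hχeq _ (h4t t)]
          exact cutoff_eq_one hε0 h1 h2
        rw [hφ1, one_mul]
        linarith [hmB _ hB']
      · rw [hT]
        have : (1 + ε - 1) / (2 * m) = ε / m / 2 := by field_simp; ring
        rw [this]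
        have : 0 ≤ ε / m := by positivity
        linarith
  -- conclusion
  refine ⟨θ, T, hθs.continuous, h0, hT0, fun y hy hyD t ht => ?_, fun y hy hyD => ?_⟩
  · rcases hdich y with ⟨-, hst⟩ | hmv
    · rw [hst t]; exact ⟨hy, hyD⟩
    · obtain ⟨hnt, hmono, hx1, -⟩ := hmov y hyD hmv
      refine ⟨by linarith [hnt t], fun hD => ?_⟩
      have := hmono t ht
      linarith [hD.2]
  · rcases hdich y with ⟨hWy, hst⟩ | hmv
    · refine Or.inl ⟨hst T, fun ⟨hg, hG⟩ => ?_⟩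
      have h4 : ∀ j, (1 : ℝ) / 4 < holeTerm k j y := fun j => lt_of_lt_of_le (by norm_num) (hg j)
      have h1 : 1 < levelFun k y := one_lt_levelFun_of_not_mem (hpos4 y h4) hyD
      have hχ1 : χ y = 1 := by rw [hχeq y h4]; exact cutoff_eq_one hε0 h1.le hG
      have := hWχ y hWy
      rw [hχ1] at this
      exact one_ne_zero this
    · obtain ⟨hnt, -, -, hT'⟩ := hmov y hyD hmv
      exact Or.inr ⟨hnt T, hT'⟩

end FriendsH2

/-- **Registered helper (HF part 3 of `stub_friendsH2`)**: Milnor's push of `B(0, R + 3) ∖ D_k` through the regular band `1 ≤ G_k ≤ 1 + ε` of the model level function (Morse theory, Thm. 3.1). [cite: Milnor1963, Thm. 3.1] -/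
theorem helper_friendsH2_pushingFlow : ∀ k : ℕ, ∃ (θ : ℝ × EuclideanSpace ℝ (Fin 4) → EuclideanSpace ℝ (Fin 4)) (T : ℝ), Continuous θ ∧ (∀ x, θ (0, x) = x) ∧ 0 ≤ T ∧ (∀ y : EuclideanSpace ℝ (Fin 4), ‖y‖ < 40 * ((k : ℝ) + 1) + 3 → y ∉ Literature.Topology.FourManifolds.MMSW.modelHandlebody k → ∀ t : ℝ, 0 ≤ t → ‖θ (t, y)‖ < 40 * ((k : ℝ) + 1) + 3 ∧ θ (t, y) ∉ Literature.Topology.FourManifolds.MMSW.modelHandlebody k) ∧ (∀ y : EuclideanSpace ℝ (Fin 4), ‖y‖ < 40 * ((k : ℝ) + 1) + 3 → y ∉ Literature.Topology.FourManifolds.MMSW.modelHandlebody k → (θ (T, y) = y ∧ ¬ ((∀ j, (1 : ℝ) / 2 ≤ Literature.Topology.FourManifolds.MMSW.holeTerm k j y) ∧ Literature.Topology.FourManifolds.MMSW.levelFun k y ≤ 1 + 1 / (4 * (40 * ((k : ℝ) + 1))))) ∨ (‖θ (T, y)‖ < 40 * ((k : ℝ) + 1) + 2 ∧ 1 + 1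 / (4 * (40 * ((k : ℝ) + 1))) < Literature.Topology.FourManifolds.MMSW.levelFun k (θ (T, y)))) := FriendsH2.exists_pushing_flow

end Summit.SmoothPoincare4.SmoothPoincare4.Theorems.DcrGap.MkFriends

end
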